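import Summits.AtomisticToContinuum.HydrodynamicLimit.Theses.TwoTimePressureGerm

/-!
# Birth skeleton of the crux `MeanEulerLimit` (stmt-AtomisticToContinuum-17727)

Route `route-AtomisticToContinuum-TwoTimePressureGerm`, crux decl
`Summit.AtomisticToContinuum.HydrodynamicLimit.Theses.TwoTimePressureGerm.MeanEulerLimit` (rank 4: SLOPE OF
THE EULER GERM = IDENTIFICATION IN THE MEAN, packing-guarded frame of the re-typed conjunct: under the initial
local Gibbs law, the EXPECTATIONS of the time-`t` empirical density / momentum / energy fields tested against a
continuous `χ` converge to `∫χρ_t`, `∫χρ_t u_t`, `∫χE_t` for every classical hard-sphere Euler solution that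
stays dilute, `t < T`). Skeleton registrar `planner-skel-stmt-AtomisticToContinuum-17727-0`, 2026-08-17 (BC3
birth certificate; re-audit bin REPAIRABLE). Nothing here restates the crux or the Statement.

THE LINE (kinetic-theory reading of "identification in the mean", Spohn 1991 Part I §3.2: local equilibrium
(3.13) ⇒ Euler (3.21), run at the ONE-BODY level and IN EXPECTATION). The intermediate OBJECT is the mean
one-body marginal at macroscopic time `t`,
`F_N^t(ψ) = E_{localGibbs} ∫ ψ dμ^emp(Φ_t z) = E[(N+1)⁻¹ Σᵢ ψ(xᵢ(t), vᵢ(t))]` (`meanOneBody`),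
tested against continuous one-body observables `ψ(x, v)` of at most QUADRATIC growth in `v` (`QuadGrowth`: the
growth class of the five collision invariants `1, v, |v|²/2` times `χ(x)`, and of the kinetic stress `vᵢvⱼχ(x)`),
and the property `MeanLocalEquilibriumAt t`: `F_N^t(ψ) → ∫ ρ_t(x) ∫ ψ(x, v) M_{1,u_t(x),θ_t(x)}(v) dv dx` for all
such `ψ` — the mean one-body marginal is asymptotically the local Maxwellian of the Euler solution
(`localEqValue`, built on the Literature `localMaxwellian`). The crux's conclusion is the five-moment shadow of
`MeanLocalEquilibriumAt t`; the three stubs are the three genuinely different moves that produce it: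

* `stub_staticLocalEquilibrium` (S1, STATICS + IDENTIFICATION OF THE DATA; size M–L, provable now): for
  continuous positive profiles and `σ < σ₀(profiles)`, a classical solution on `[0,T)` with `0 < T`, and a flow
  family: the crux's hypothesis (convergence IN PROBABILITY of the three local-Gibbs fields at `t = 0` to the
  Euler data) implies `MeanLocalEquilibriumAt 0`. Why plausibly true: under `localGibbsLaw σ a₀ u₀ θ₀` the
  velocities are, given the positions, independent Maxwellians `M_{1,u₀(xᵢ),θ₀(xᵢ)}`, so
  `F_N^0(ψ) = E[n_N(ψ̄)]` with `ψ̄(x) = ∫ψ(x,v)M_{1,u₀(x),θ₀(x)}(v)dv` continuous and bounded — a mean DENSITY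
  field, whose limit `∫ψ̄ρ(0,·)` follows from the LLN hypothesis by boundedness (`|n_N(ψ̄)| ≤ sup|ψ̄|`, the law
  is a probability measure for `σ ≤ 1/2`: `isProbabilityMeasure_localGibbsLaw`); and the momentum / energy parts
  of the same LLN force `u₀ = u(0,·)`, `θ₀ = θ(0,·)` (since `ρ(0,·) > 0`), which turns `∫ψ̄ρ(0,·)` into
  `localEqValue (ρ 0) (u 0) (θ 0) ψ`. Leans on: `localGibbsLaw`, `localGibbsProfile`, `canonicalDensity`,
  `integral_localMaxwellian_smul` / `integral_localMaxwellian_one` (HardSphereEulerProofs), `localGibbs_lln_holds`.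
* `stub_localEquilibriumPropagation` (S2, THE HEART — PROPAGATION OF ONE-BODY LOCAL EQUILIBRIUM IN THE MEAN;
  open): there is a packing threshold `η > 0` such that for continuous positive profiles and `σ < σ₀(profiles)`,
  for every classical hard-sphere Euler solution on `[0,T)` with `ρσ³ < η` throughout, every flow family, LLN
  data at `t = 0` and `MeanLocalEquilibriumAt 0`: `MeanLocalEquilibriumAt t` at every `t ∈ [0,T)`. This is
  Spohn's local-equilibrium hypothesis in its weakest form (one-body marginal, in expectation, quadratic-growth
  observables, pre-shock, dilute band): it says the mean one-body velocity statistics at `(t, x)` are Maxwellian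
  with the Euler parameters — in particular the KINETIC parts of the mean momentum / energy currents close on
  `ρ(u⊗u + θ𝟙)`, `(E + ρθ)u` (the collisional transfer `ρθ(Z(ρσ³) − 1)` is two-body and is NOT asserted here;
  the crux reads only conserved densities). In the route's currency it is the `b`-slope at `b = 0` of the scaled
  cgf of ONE-BODY observables under the `λ`-tilted invariant law (Spohn (7.16) at order 1 in `b`, all orders in
  the data): near equilibrium it is reached from `CumulantBounds` + `EquilibriumResponse` through `EngineNearEq`
  with one-body `X`; large data need the route's zoom. Why it might fail = the crux's own why-line (a
  non-Gibbsian Euler-scale structure of the deterministic flow at fixed `σ`: Boltzmann-hypothesis failure, a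
  hidden slow one-body mode; nothing controls hard spheres beyond kinetic times `O(N^{-1/3})`), PLUS the extra,
  independently falsifiable content that fourth velocity moments / the kinetic stress are locally Maxwellian in
  the mean (MD-checkable). Leans on: `HardSphereFlow` (trajectory structure, `configEnergy_eq_holds`),
  `IsHardSphereEulerSolution`, the route's `CumulantBounds` / `EquilibriumResponse` near equilibrium.
* `stub_maxwellianMomentReadout` (S3, GAUSSIAN MOMENTS + BOCHNER BOOKKEEPING; size M, provable now): for
  continuous positive profiles and `σ < σ₀(profiles)`, a classical solution on `[0,T)`, a flow family and
  `t ∈ [0,T)`: `MeanLocalEquilibriumAt t` implies the crux's three limits at `t` for every continuous `χ`.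
  Why true: take `ψ = χ(x)`, `χ(x)v_l`, `χ(x)|v|²/2` (quadratic growth since `χ` is bounded on the compact
  torus); `∫M_{1,u,θ} = 1`, `∫vM = u`, `∫|v|²/2 M = |u|²/2 + 3θ/2` for `θ_t(x) > 0`
  (`IsHardSphereEulerSolution.temperature_pos`; `integral_localMaxwellian_smul` = affine Gaussian change of
  variables); the three `meanOneBody` values are `E n_t(χ)`, `E (p_t(χ))_l`, `E e_t(χ)` by unfolding
  `empiricalDensityField` / `empiricalMomentumField` / `empiricalEnergyField`; the VECTOR limit of the mean
  momentum field from its coordinates needs `(∫ p ∂LG)_l = ∫ p_l ∂LG`, i.e. Bochner integrability of the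
  time-`t` momentum field under the local Gibbs law (`‖p_t(χ)‖ ≤ sup|χ|(1 + 2·KE/(N+1))`, kinetic energy
  conserved along good orbits, Gaussian at `t = 0`) — the one non-formal step, whence the `σ < σ₀` frame.
* Composition `MeanEulerLimit_of : S1 → S2 → S3 → MeanEulerLimit` (sorry-free; real content: the packing
  threshold is S2's `η`, the density threshold `min σ₁ (min σ₂ σ₃)`, `0 < T` from `t ∈ [0,T)`, and the chaining
  S3 ∘ S2 ∘ S1 at each `t`), and `MeanEulerLimit_skeleton` = the crux modulo the three sorries.

Disproof used: none exists for this crux (`ledger crux ls stmt-AtomisticToContinuum-17727`: no workfiles at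
registration). Negatives index (20 entries, 2026-08-17): no refuted statement is an instance of S1–S3 — the
nearest, `EulerCharacteristics.ExpTailBudget` (14607, exponential currency + CUBIC velocity weight, false at
`t = 0`), is avoided by construction: everything here is in expectation with quadratic-growth observables, true
at `t = 0` by Gaussian statics (S1).
-/

noncomputable section

open MeasureTheory Filter Set
open scoped ENNReal Topology

namespace Summit.AtomisticToContinuum.HydrodynamicLimit.Cruxes.MeanEulerLimit.Birth

open Literature.MathematicalPhysics.KineticTheory Literature.Analysis.FluidPDE
open Summit.AtomisticToContinuum.HydrodynamicLimit.Theses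

/-! ## §0 Objects of the line -/

/-- One-body observables of at most quadratic growth in the velocity: `|ψ(x,v)| ≤ C(1 + |v|²)` (the class of
`χ(x)`, `χ(x)v_l`, `χ(x)|v|²/2`, `χ(x)vᵢvⱼ` for bounded `χ`). -/
def QuadGrowth (ψ : T3 × V3 → ℝ) : Prop :=
  ∃ C : ℝ, ∀ y, |ψ y| ≤ C * (1 + ‖y.2‖ ^ 2)

/-- The **mean one-body functional at time `t`**: `E_{localGibbs} ∫ ψ dμ^emp(Φ_t z)`, the one-body marginal
(intensity measure) of the time-`t` law tested against `ψ`. -/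
def meanOneBody (σ : ℝ) (a₀ : T3 → ℝ) (u₀ : T3 → V3) (θ₀ : T3 → ℝ) (N : ℕ)
    (Φ : HardSphereFlow (Literature.Analysis.FluidPDE.Torus.geometry (Fin 3)) (hsDiameter σ N) (N + 1))
    (t : ℝ) (ψ : T3 × V3 → ℝ) : ℝ :=
  ∫ z, (∫ y, ψ y ∂(empiricalMeasure (Φ.flow t z))) ∂(localGibbsLaw σ a₀ u₀ θ₀ N Φ)

/-- The **local-equilibrium value** of the one-body observable `ψ` in the macroscopic state `(r, w, ϑ)`:
`∫ r(x) ∫ ψ(x,v) M_{1,w(x),ϑ(x)}(v) dv dx` (Literature `localMaxwellian`; meaningful for `ϑ > 0`). -/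
def localEqValue (r : T3 → ℝ) (w : T3 → V3) (ϑ : T3 → ℝ) (ψ : T3 × V3 → ℝ) : ℝ :=
  ∫ x, r x * ∫ v, ψ (x, v) * localMaxwellian 1 (ϑ x) (w x) v

/-- **Mean one-body local equilibrium at time `t`** along the macroscopic fields `(ρ, u, θ)`: for every
continuous one-body observable of quadratic growth, the mean one-body functional at time `t` converges to its
local-Maxwellian value in the state `(ρ_t, u_t, θ_t)`. -/
def MeanLocalEquilibriumAt (σ : ℝ) (a₀ : T3 → ℝ) (u₀ : T3 → V3) (θ₀ : T3 → ℝ)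
    (Φ : (N : ℕ) → HardSphereFlow (Literature.Analysis.FluidPDE.Torus.geometry (Fin 3)) (hsDiameter σ N) (N + 1))
    (ρ : ℝ → T3 → ℝ) (u : ℝ → T3 → V3) (θ : ℝ → T3 → ℝ) (t : ℝ) : Prop :=
  ∀ ψ : T3 × V3 → ℝ, Continuous ψ → QuadGrowth ψ →
    Tendsto (fun N : ℕ => meanOneBody σ a₀ u₀ θ₀ N (Φ N) t ψ) atTop
      (𝓝 (localEqValue (ρ t) (u t) (θ t) ψ))

/-! ## §1 Stub signatures

Each stub's statement is the `Prop` `Sig.stub_<name>`; the registered obligation is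
`theorem stub_<name> : Sig.stub_<name> := by sorry` (§2); the composition `MeanEulerLimit_of` takes the three
signatures as hypotheses BY NAME. -/

/-- **S1 — static local equilibrium and identification of the data (size M–L, provable now).** For continuous
positive profiles and `σ < σ₀(profiles)`: if a classical solution on `[0,T)`, `0 < T`, has its time-`0` fields as
the limit IN PROBABILITY of the local-Gibbs empirical fields (the crux's hypothesis), then the mean one-body
marginal at `t = 0` is asymptotically the local Maxwellian of the Euler data: `MeanLocalEquilibriumAt 0`. -/
def Sig.stub_staticLocalEquilibrium : Prop :=
  ∀ (a₀ θ₀ : T3 → ℝ) (u₀ : T3 → V3), Continuous a₀ → Continuous θ₀ → Continuous u₀ →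
    (∀ x, 0 < a₀ x) → (∀ x, 0 < θ₀ x) →
    ∃ σ₀ : ℝ, 0 < σ₀ ∧ ∀ σ : ℝ, 0 < σ → σ < σ₀ →
      ∀ (T : ℝ) (ρ θ : ℝ → T3 → ℝ) (u : ℝ → T3 → V3), IsHardSphereEulerSolution σ T ρ u θ → 0 < T →
        ∀ Φ : (N : ℕ) → HardSphereFlow (Literature.Analysis.FluidPDE.Torus.geometry (Fin 3)) (hsDiameter σ N) (N + 1),
          TendstoHydroFieldsAt (fun N => localGibbsLaw σ a₀ u₀ θ₀ N (Φ N)) Φ ρ u θ 0 →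
            MeanLocalEquilibriumAt σ a₀ u₀ θ₀ Φ ρ u θ 0

/-- **S2 — propagation of one-body local equilibrium in the mean (THE HEART; open).** There is a packing
threshold `η > 0` such that for continuous positive profiles and `σ < σ₀(profiles)`, for every classical
hard-sphere Euler solution on `[0,T)` with `ρσ³ < η` throughout, every flow family, LLN data at `t = 0` and mean
one-body local equilibrium at `t = 0`: mean one-body local equilibrium holds at every `t ∈ [0,T)`. -/
def Sig.stub_localEquilibriumPropagation : Prop :=
  ∃ η : ℝ, 0 < η ∧
    ∀ (a₀ θ₀ : T3 → ℝ) (u₀ : T3 → V3), Continuous a₀ → Continuous θ₀ → Continuous u₀ →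
      (∀ x, 0 < a₀ x) → (∀ x, 0 < θ₀ x) →
      ∃ σ₀ : ℝ, 0 < σ₀ ∧ ∀ σ : ℝ, 0 < σ → σ < σ₀ →
        ∀ (T : ℝ) (ρ θ : ℝ → T3 → ℝ) (u : ℝ → T3 → V3), IsHardSphereEulerSolution σ T ρ u θ →
          (∀ t ∈ Ico 0 T, ∀ x, ρ t x * σ ^ 3 < η) →
          ∀ Φ : (N : ℕ) → HardSphereFlow (Literature.Analysis.FluidPDE.Torus.geometry (Fin 3)) (hsDiameter σ N) (N + 1),
            TendstoHydroFieldsAt (fun N => localGibbsLaw σ a₀ u₀ θ₀ N (Φ N)) Φ ρ u θ 0 →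
              MeanLocalEquilibriumAt σ a₀ u₀ θ₀ Φ ρ u θ 0 →
                ∀ t ∈ Ico 0 T, MeanLocalEquilibriumAt σ a₀ u₀ θ₀ Φ ρ u θ t

/-- **S3 — Maxwellian moment readout (size M, provable now).** For continuous positive profiles and
`σ < σ₀(profiles)`, a classical solution on `[0,T)`, a flow family and `t ∈ [0,T)`: mean one-body local
equilibrium at `t` yields the crux's three limits at `t` — `E n_t(χ) → ∫χρ_t`, `E p_t(χ) → ∫χρ_t u_t` (as a
vector), `E e_t(χ) → ∫χE_t` — for every continuous `χ` (Gaussian moments `1, u, |u|²/2 + 3θ/2` of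
`M_{1,u,θ}`, `θ_t > 0`, plus Bochner integrability of the time-`t` momentum field under the local Gibbs law). -/
def Sig.stub_maxwellianMomentReadout : Prop :=
  ∀ (a₀ θ₀ : T3 → ℝ) (u₀ : T3 → V3), Continuous a₀ → Continuous θ₀ → Continuous u₀ →
    (∀ x, 0 < a₀ x) → (∀ x, 0 < θ₀ x) →
    ∃ σ₀ : ℝ, 0 < σ₀ ∧ ∀ σ : ℝ, 0 < σ → σ < σ₀ →
      ∀ (T : ℝ) (ρ θ : ℝ → T3 → ℝ) (u : ℝ → T3 → V3), IsHardSphereEulerSolution σ T ρ u θ →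
        ∀ Φ : (N : ℕ) → HardSphereFlow (Literature.Analysis.FluidPDE.Torus.geometry (Fin 3)) (hsDiameter σ N) (N + 1),
          ∀ t ∈ Ico 0 T, MeanLocalEquilibriumAt σ a₀ u₀ θ₀ Φ ρ u θ t →
            ∀ χ : T3 → ℝ, Continuous χ →
              Tendsto (fun N : ℕ => ∫ z, empiricalDensityField ((Φ N).flow t z) χ
                ∂(localGibbsLaw σ a₀ u₀ θ₀ N (Φ N))) atTop (𝓝 (∫ x, χ x * ρ t x)) ∧
              Tendsto (fun N : ℕ => ∫ z, empiricalMomentumField ((Φ N).flow t z) χ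
                ∂(localGibbsLaw σ a₀ u₀ θ₀ N (Φ N))) atTop (𝓝 (∫ x, (χ x * ρ t x) • u t x)) ∧
              Tendsto (fun N : ℕ => ∫ z, empiricalEnergyField ((Φ N).flow t z) χ
                ∂(localGibbsLaw σ a₀ u₀ θ₀ N (Φ N))) atTop
                (𝓝 (∫ x, χ x * totalEnergyDensity (ρ t x) (u t x) (θ t x)))

/-! ## §2 Stubs (registered; `sorry` only inside them) — hardest: `stub_localEquilibriumPropagation` -/

/-- **S1 (M–L, provable now).** Static local equilibrium + identification of the Euler data at `t = 0`. -/
theorem stub_staticLocalEquilibrium : Sig.stub_staticLocalEquilibrium := by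
  sorry

/-- **S2 (the heart; open).** Propagation of one-body local equilibrium in the mean, dilute band, pre-shock. -/
theorem stub_localEquilibriumPropagation : Sig.stub_localEquilibriumPropagation := by
  sorry

/-- **S3 (M, provable now).** Maxwellian moment readout of the three conserved fields. -/
theorem stub_maxwellianMomentReadout : Sig.stub_maxwellianMomentReadout := by
  sorry

/-! ## §3 Composition (sorry-free) -/

/-- **The line closes the crux modulo its stubs**: `MeanEulerLimit` BY NAME from S1, S2, S3. Real content: the
packing threshold is S2's `η`, the common density threshold `min σ₁ (min σ₂ σ₃)`, `0 < T` extracted from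
`t ∈ [0,T)`, and the chaining readout ∘ propagation ∘ statics at each time `t`. -/
theorem MeanEulerLimit_of (h₁ : Sig.stub_staticLocalEquilibrium)
    (h₂ : Sig.stub_localEquilibriumPropagation) (h₃ : Sig.stub_maxwellianMomentReadout) :
    TwoTimePressureGerm.MeanEulerLimit := by
  obtain ⟨η, hη, H₂⟩ := h₂
  refine ⟨η, hη, ?_⟩
  intro a₀ θ₀ u₀ ha hθ hu hap hθp
  obtain ⟨σ₁, hσ₁, G₁⟩ := h₁ a₀ θ₀ u₀ ha hθ hu hap hθp
  obtain ⟨σ₂, hσ₂, G₂⟩ := H₂ a₀ θ₀ u₀ ha hθ hu hap hθp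
  obtain ⟨σ₃, hσ₃, G₃⟩ := h₃ a₀ θ₀ u₀ ha hθ hu hap hθp
  refine ⟨min σ₁ (min σ₂ σ₃), lt_min hσ₁ (lt_min hσ₂ hσ₃), ?_⟩
  intro σ hσ hσlt T ρ θ u hsol hpack Φ h0 t ht χ hχ
  have hσ₁' : σ < σ₁ := lt_of_lt_of_le hσlt (min_le_left _ _)
  have hσ₂' : σ < σ₂ := lt_of_lt_of_le hσlt ((min_le_right _ _).trans (min_le_left _ _))
  have hσ₃' : σ < σ₃ := lt_of_lt_of_le hσlt ((min_le_right _ _).trans (min_le_right _ _))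
  have hT : 0 < T := lt_of_le_of_lt ht.1 ht.2
  have h0mean : MeanLocalEquilibriumAt σ a₀ u₀ θ₀ Φ ρ u θ 0 :=
    G₁ σ hσ hσ₁' T ρ θ u hsol hT Φ h0
  have htmean : MeanLocalEquilibriumAt σ a₀ u₀ θ₀ Φ ρ u θ t :=
    G₂ σ hσ hσ₂' T ρ θ u hsol hpack Φ h0 h0mean t ht
  exact G₃ σ hσ hσ₃' T ρ θ u hsol Φ t ht htmean χ hχ

/-- The skeleton instantiated: the crux modulo the three registered stubs. -/
theorem MeanEulerLimit_skeleton : TwoTimePressureGerm.MeanEulerLimit :=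
  MeanEulerLimit_of stub_staticLocalEquilibrium stub_localEquilibriumPropagation
    stub_maxwellianMomentReadout

end Summit.AtomisticToContinuum.HydrodynamicLimit.Cruxes.MeanEulerLimit.Birth

end
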